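import Literature.MathematicalPhysics.QuantumFieldTheory.Balaban1983to89.Beta.RemainderChainTorus

/-!
# Beta / RoadP2Chain — BINDER-OWNERS row D4, co-owner road P2′: the remainder chain with a COUPLING-DEPENDENT activity
# budget `A(g_k)` (the (AF-1w) «ω-form» of the (D4) binder), kernel-checked by name from the row owner's chain, and its
# wall END with NO numeric threshold restriction
# (β sub-cell, unit `b2b-balaban-beta-d4-p2`, generation 1; leaves D.1/D.2/T.1 of `HOME/beta/skeletons/D4-b2b-balaban-beta-d4-p2.md`)

HONEST FRAMING (page 1 of everything the β sub-cell writes): discharging `BetaPertH` makes Bałaban's UV stability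
UNCONDITIONAL — a real constructive-QFT result; it is NOT the continuum limit and NOT the Clay problem.  HONEST DEPENDENCY
(cell reorg 2026-08-19, verbatim): «continuum YM on T⁴ ⇐ BetaPertH ∧ nine spine estimates (0/9 proved); BetaPertH ⇐ (D1) ∧
(D4) ∧ CAP+tail; G-an2-4 gates asym, D1 and NE2/3/4.»  THIS MODULE INSTANTIATES NO BINDER AND ASSERTS NOTHING ABOUT
BAŁABAN'S β-FUNCTIONS: every declaration is a definition, a HYPOTHESIS STRUCTURE (whose fields are displayed hypotheses,
never facts), or a theorem proved from the UNMODIFIED Literature modules `Beta.RemainderChain`, `Beta.RemainderChainTorus`,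
`Beta.RemainderChainLattice`, `Beta.DriftRemainder`, `B12Decay510Torus`, `FlowStep`, `DagBinding` (imported BY NAME).

ABSOLUTE RULE (cell charter, verbatim): "No internally-minted statement may enter as a cited fact. Every hypothesis is
either kernel-proved in this package or a verbatim quotation of a PUBLISHED theorem with page reference. The manuscript(s)
under audit are NOT citable for their own disputed steps — they are the thing under adjudication; programme-internal
(2001/route/tribunal) claims are never citable."

## What row D4 is, and what road P2′ changes in it

Row D4 = the binder pair `(hrem : RemainderConst Sβ γ₀ rr) (hr : rr ≤ B12Normalization.stepBal N Lc)` of the β wall's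
END (`DriftRemainder.endpointExistence_of_drift_remainderConst_cont`: `OneLoopDrift b A S.β0 → RemainderConst S γ₀ r →
r ≤ b → BetaContH γ₀ β → EndpointExistence C`).  The row OWNER's road P1 (lineage an4) types Bałaban's printed chain
[Balaban1988RG2Cluster] (= [II]) Lemma 3 (2.38) ⟹ (2.41) ⟹ [Balaban1987RG1] (= [I]) (4.4)/(4.35)/p. 282/(5.10)/(1.22)
with ONE activity constant `A_rem = O(1)·C₃·ε₁` for all scales and histories (`RemainderChain.Chain`,
`RemainderChainTorus.ChainT`), whence the CONSTANT form `|β¹_{k+1}| ≤ ε₁·K_rem` and the inserted numeric restriction N3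
`ε₁·K_rem ≤ b` (`REMAINDER-BETA.md` §3; certified SHARP by the owner, `RemainderThresholdSharp` p198581).

The co-owner's road P2′ (skeleton `HOME/beta/skeletons/D4-b2b-balaban-beta-d4-p2.md` §2) replaces the SOURCE of the
activity bound: [Balaban1988Convergent] (= [III]) (3.30) p. 272 — verbatim «[the logarithm on the right-hand side of
(3.28)] = log[z^{(k)}∫dA exp[−½⟨A,C*Δ^{(k)}CA⟩]] + log∫dμ_{C^{(k)}(Λ_{k+1})}χ^{(k)} + g_k∫₀¹dt ⟨∂/∂tg_k P^{(k)}(tg_k,A) +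
∂/∂tg_k 𝐄_k(U_k(…tg_kCA…))⟩_t» — splits the new effective-action term into the χ-free Gaussian normalization (row D1's
one-loop object), a cut-off term, and `g_k` TIMES an expectation of a polynomial INSERTION ((3.31) p. 273), whose localized
expansion (3.44)–(3.47) pp. 277–278 has terms bounded, in print, by «(2.42), with the constant B₀ replaced by O(p₀³(g_k))
… and the multiplication by g_k yields small bounds» (p. 278 ll. 15–18; cut-off (3.16) p. 268: `|A(b)| < r_k =
A₁(log g_k^{−2})^{p₀}` on the unit-covariance variable).  On road P2′ the (I.1.18)-type bound of the β¹-GENERATING terms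
therefore carries a COUPLING-DEPENDENT budget `A(g_k)` with `A(g) → 0` as `g → 0⁺` (skeleton (J7): `A(g) =
A₂′C₃′·g·(C_V‖C‖³r(g)³ + C_E r(g)) + A₂″C_χ·exp(−λ₀r(g)²/4)`) instead of `O(1)C₃ε₁` — everything DOWNSTREAM of the activity
bound ([I] (4.4) seam, Cauchy at the ABSOLUTE radius α₂, p. 282 decay, (4.37)/(5.10) summation, (5.1) limit, (1.22)) is the
row owner's kernel chain, which is LINEAR in the activity (`RemainderChain.PolLeaves.decay510`, `abs_secondMoment_le_linear`).

THIS FILE supplies exactly that downstream half for a VARIABLE budget, BY NAME: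
* §1 `RemainderMod S γ ω` — the ω-FORM of the remainder binder: `|β¹_{k+1}(g_0,…,g_k)| ≤ ω(g_k)` on `]0,γ]^{k+1}`; it gives
  the constant form `RemainderConst S γ (ω γ)` for monotone ω (`remainderConst_of_mod`) and contains (AF-1) (`ω g = C·g`).
* §2 `ChainVar` — the owner's abstract chain `RemainderChain.Chain` with the activity slot `remActivity c` replaced by
  `A (p (Fin.last k))`; `ChainVar.abs_beta1_le` = the owner's four-line proof verbatim ⟹ `RemainderMod S γ (A · K)` with the
  SAME closed coefficient `K = β′_d(K_Π, δ₁)` (`modCoeff`); `ChainVar.remainderConst` for monotone `A`.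
* §3 `remainderConst_anti`, `exists_threshold` — the THRESHOLD (hr) is met by SHRINKING γ when `A(g) → 0` (`Tendsto A (𝓝[>] 0)
  (𝓝 0)`): NO inserted restriction of the N3 type; this is [I] Thm 3 p. 264's own clause «The constant γ depends on all other
  constants.» — the owner's `endpointExistence_of_drift_af1` observation («(AF-1) with ANY constant needs NO numeric
  restriction») extended from the linear to any vanishing modulus.
* §4 END `endpointExistence_of_chainVar` = `DriftRemainder.endpointExistence_of_drift_remainderConst_cont` ∘ §2 ∘ §3.
* §5 the PERIODIC carrier: `PolLeavesT118` = the owner's torus leaf list `RemainderChainTorus.PolLeavesT` with the three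
  [II]-side fields (`hsp`, `hrep`, `h238`: restriction property, (2.13) representation, Lemma 3) REPLACED by the single
  (I.1.18)-level field `h118` (the OUTPUT of road P2′'s marked resummation, skeleton NODE R), every geometric leaf discharged
  on the torus exactly as in `PolLeavesT.toPolLeaves`; `ChainVarT` and its END `endpointExistence_of_chainVarT`.

WHAT STAYS LOCATED (skeleton §3, unchanged by this file): NODE O (Bałaban's objects, XL, unowned); the apex A′ ([II] Lemma 3
for the unmarked activities = road P1's (T1)–(T4), plus the marked-polymer bound asserted at [III] p. 277 l. −1 «Although
different, it satisfies the same bound as the other factors»); the cut-off term's Gaussian tail (GAPS C-adv5-22, reader-level);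
NODE B ([I] (4.4) seam); the [model] dictionary (T12).  NOT CLAIMED: any instance of `ChainVar`/`ChainVarT` for Bałaban's
construction; anything of `BetaPertH`; NOT continuum, NOT Clay, NOT summit progress.
-/

namespace Summit.QuantumFields.BalabanUV.Beta.RoadP2Chain

open Literature.MathematicalPhysics.QuantumFieldTheory.Balaban1983to89
open FlowStep DagBinding FlowStepRuns
open Literature.MathematicalPhysics.QuantumFieldTheory.Balaban1983to89.B12TreeDecay (kappa₀ K₀ K₀_pos)
open Literature.MathematicalPhysics.QuantumFieldTheory.Balaban1983to89.TreeLengthTorus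
  (TPt TDom proj tsys tcubeSys torusTreeLen)
open Literature.MathematicalPhysics.QuantumFieldTheory.Balaban1983to89.B12Decay510 (delta1 delta1_pos mixedDeriv)
open Literature.MathematicalPhysics.QuantumFieldTheory.Balaban1983to89.B12Decay510Window (K₁)
open Literature.MathematicalPhysics.QuantumFieldTheory.Balaban1983to89.B12Decay510Torus
  (pl1 distCT nearT geomT geomLeafT cubeSumLeafT treeLeafT pl1_proj_zero_sub_proj_eventually)
open Literature.MathematicalPhysics.QuantumFieldTheory.Balaban1983to89.Beta.RemainderChain
  (PolLeaves RemainderConst polConst polConst_nonneg abs_secondMoment_le_linear remainderConst_of_af1)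
open Literature.MathematicalPhysics.QuantumFieldTheory.Balaban1983to89.Beta.Drift (OneLoopDrift)
open Literature.MathematicalPhysics.QuantumFieldTheory.Balaban1983to89.Beta.DriftRemainder
  (endpointExistence_of_drift_remainderConst_cont)
open Metric Filter Topology Set

noncomputable section

variable {d : ℕ}

/-! ## §1 The ω-form of the remainder binder -/

/-- [folklore] **THE ω-FORM (AF-1w) OF THE REMAINDER BINDER**: `|β¹_{k+1}(g_0,…,g_k)| ≤ ω(g_k)` for every scale k and
every history in `]0,γ]^{k+1}`, the modulus `ω` a function of the LAST coupling only (BETA-SPEC §4 (b)).  Road P1's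
constant form is `ω ≡ ε₁K_rem`; (AF-1) is `ω g = C·g`; road P2′ delivers `ω g = A(g)·K` with `A(g) → 0`. -/
def RemainderMod {β : HBeta} (S : B12Beta.OneLoopSplit β) (γ : ℝ) (ω : ℝ → ℝ) : Prop :=
  ∀ k (p : Fin (k + 1) → ℝ), p ∈ B12Beta.HistBox γ k → |S.β1 k p| ≤ ω (p (Fin.last k))

/-- [folklore] A modulus monotone on `]0,γ]` gives the CONSTANT form with `r := ω γ`. -/
theorem remainderConst_of_mod {β : HBeta} {S : B12Beta.OneLoopSplit β} {γ : ℝ} {ω : ℝ → ℝ}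
    (h : RemainderMod S γ ω) (hmono : MonotoneOn ω (Ioc 0 γ)) : RemainderConst S γ (ω γ) := by
  intro k p hp
  have hlast : p (Fin.last k) ∈ Ioc 0 γ := ⟨(hp (Fin.last k)).1, (hp (Fin.last k)).2⟩
  have hγ : γ ∈ Ioc 0 γ := ⟨lt_of_lt_of_le hlast.1 hlast.2, le_rfl⟩
  exact (h k p hp).trans (hmono hlast hγ hlast.2)

/-- [folklore] (AF-1) `|β¹_{k+1}| ≤ C·g_k` IS the ω-form with the linear modulus. -/
theorem remainderMod_of_af1 {β : HBeta} {S : B12Beta.OneLoopSplit β} {γ C : ℝ}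
    (hAF1 : ∀ k (p : Fin (k + 1) → ℝ), p ∈ B12Beta.HistBox γ k → |S.β1 k p| ≤ C * p (Fin.last k)) :
    RemainderMod S γ (fun g => C * g) := hAF1

/-- [folklore] The ω-form restricts to smaller boxes. -/
theorem RemainderMod.anti {β : HBeta} {S : B12Beta.OneLoopSplit β} {γ γ' : ℝ} {ω : ℝ → ℝ} (hγ : γ' ≤ γ)
    (h : RemainderMod S γ ω) : RemainderMod S γ' ω :=
  fun k p hp => h k p fun i => ⟨(hp i).1, (hp i).2.trans hγ⟩

/-- [folklore] The constant form restricts to smaller boxes. -/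
theorem remainderConst_anti {β : HBeta} {S : B12Beta.OneLoopSplit β} {γ γ' r : ℝ} (hγ : γ' ≤ γ)
    (h : RemainderConst S γ r) : RemainderConst S γ' r :=
  fun k p hp => h k p fun i => ⟨(hp i).1, (hp i).2.trans hγ⟩

/-! ## §2 The chain with a coupling-dependent activity budget (abstract carrier) -/

/-- The closed, activity-FREE coefficient of the chain: `K := β′_d(K_Π, δ₁)` with `K_Π = polConst α₂ B₃ κ δ₀ M c₁ K₀ K₁`
(= `4α₂⁻²B₃²e^{δ₁Mc₁}K₀K₁`, [I] (4.37)/(5.10)) and `β′_d(C, δ₁) = C·Σ_{x∈ℤ^d}|x|₁²e^{−δ₁|x|₁}` ((5.42)); the row owner's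
`remCoeff` is `A₂·C₃·K`. -/
def modCoeff (d : ℕ) (α₂ B₃ κ δ₀ M c₁ K₀ K₁ : ℝ) : ℝ :=
  B12Sec2to5.betaPrime510 d (polConst α₂ B₃ κ δ₀ M c₁ K₀ K₁) (delta1 δ₀ κ M)

/-- `K ≥ 0` under the printed signs. -/
theorem modCoeff_nonneg (d : ℕ) {α₂ B₃ κ δ₀ M c₁ K₀ K₁ : ℝ} (hK₀ : 0 ≤ K₀) (hK₁ : 0 ≤ K₁) :
    0 ≤ modCoeff d α₂ B₃ κ δ₀ M c₁ K₀ K₁ := by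
  unfold modCoeff B12Sec2to5.betaPrime510
  refine mul_nonneg (polConst_nonneg hK₀ hK₁) (tsum_nonneg fun x => ?_)
  positivity

/-- **THE REMAINDER CHAIN WITH A COUPLING-DEPENDENT ACTIVITY BUDGET** (road P2′; the twin of the row owner's
`RemainderChain.Chain` with the activity slot `remActivity c = A₂C₃ε₁` replaced by `A (g_k)`, `g_k = p (Fin.last k)` the
last coupling of the history): `P1 k p` = the `T ↗ ℤ^d` limit polarization kernel of the β¹-generating terms at scale k + 1
and history p; `beta1_eq` = the (1.20)/(1.22) dictionary clause; `leaves k p hp` = the (4.4)/(4.35)/p. 282/(4.37)/(5.10)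
leaf list of the owner's chain with (I.1.18)-activity `A (p (Fin.last k))`.  A HYPOTHESIS structure; on road P2′ the field
`(leaves k p hp).h118` is the output of the marked resummation of [III] (3.44)–(3.47) with the budget of p. 278 l. 16. -/
structure ChainVar (d : ℕ) (μ ν : Fin d) {β : HBeta} (S : B12Beta.OneLoopSplit β) (γ : ℝ) (A : ℝ → ℝ)
    (α₂ B₃ κ δ₀ M c₁ K₀ K₁ : ℝ) where
  /-- the infinite-volume polarization kernel of the β¹-generating terms, per scale and history -/
  P1 : (k : ℕ) → (Fin (k + 1) → ℝ) → B12Beta.Kernel d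
  /-- the (1.20)/(1.22) dictionary: β¹ is the second moment of that kernel -/
  beta1_eq : ∀ k p, p ∈ B12Beta.HistBox γ k → S.β1 k p = B12Beta.secondMoment (P1 k p) μ ν
  /-- the owner's leaf list with activity `A(g_k)` -/
  leaves : ∀ k (p : Fin (k + 1) → ℝ), p ∈ B12Beta.HistBox γ k →
    PolLeaves d (P1 k p μ ν) (A (p (Fin.last k))) α₂ B₃ κ δ₀ M c₁ K₀ K₁

/-- The signs used by the chain: the budget is non-negative on `]0,γ]`, and the printed signs of α₂, B₃, K₀, K₁, δ₀, κ, M. -/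
structure VarSigns (A : ℝ → ℝ) (γ α₂ B₃ K₀ K₁ δ₀ κ M : ℝ) : Prop where
  act : ∀ g, 0 < g → g ≤ γ → 0 ≤ A g
  α₂_pos : 0 < α₂
  B₃_nonneg : 0 ≤ B₃
  K₀_nonneg : 0 ≤ K₀
  K₁_nonneg : 0 ≤ K₁
  δ₀_pos : 0 < δ₀
  κ_pos : 0 < κ
  M_pos : 0 < M

/-- The signs restrict to smaller boxes. -/
theorem VarSigns.anti {A : ℝ → ℝ} {γ γ' α₂ B₃ K₀ K₁ δ₀ κ M : ℝ} (hs : VarSigns A γ α₂ B₃ K₀ K₁ δ₀ κ M)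
    (hγ : γ' ≤ γ) : VarSigns A γ' α₂ B₃ K₀ K₁ δ₀ κ M :=
  ⟨fun g hg hgγ => hs.act g hg (hgγ.trans hγ), hs.α₂_pos, hs.B₃_nonneg, hs.K₀_nonneg, hs.K₁_nonneg, hs.δ₀_pos,
    hs.κ_pos, hs.M_pos⟩

/-- The chain restricts to smaller boxes. -/
def ChainVar.restrict {μ ν : Fin d} {β : HBeta} {S : B12Beta.OneLoopSplit β} {γ γ' : ℝ} {A : ℝ → ℝ}
    {α₂ B₃ κ δ₀ M c₁ K₀ K₁ : ℝ} (R : ChainVar d μ ν S γ A α₂ B₃ κ δ₀ M c₁ K₀ K₁) (hγ : γ' ≤ γ) :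
    ChainVar d μ ν S γ' A α₂ B₃ κ δ₀ M c₁ K₀ K₁ where
  P1 := R.P1
  beta1_eq := fun k p hp => R.beta1_eq k p fun i => ⟨(hp i).1, (hp i).2.trans hγ⟩
  leaves := fun k p hp => R.leaves k p fun i => ⟨(hp i).1, (hp i).2.trans hγ⟩

/-- **THE ω-FORM REMAINDER BOUND, kernel-checked from the owner's chain with a variable budget**: for EVERY scale k and
EVERY history p in `]0,γ]^{k+1}`, `|β¹_{k+1}(p)| ≤ A(g_k) · K`, `K = modCoeff` — the owner's four lines
(`PolLeaves.decay510` ∘ `abs_secondMoment_le_linear`) with `remActivity c` read as `A(g_k)`. -/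
theorem ChainVar.abs_beta1_le {μ ν : Fin d} {β : HBeta} {S : B12Beta.OneLoopSplit β} {γ : ℝ} {A : ℝ → ℝ}
    {α₂ B₃ κ δ₀ M c₁ K₀ K₁ : ℝ} (R : ChainVar d μ ν S γ A α₂ B₃ κ δ₀ M c₁ K₀ K₁)
    (hs : VarSigns A γ α₂ B₃ K₀ K₁ δ₀ κ M) :
    RemainderMod S γ (fun g => A g * modCoeff d α₂ B₃ κ δ₀ M c₁ K₀ K₁) := by
  intro k p hp
  have hδ₁ : 0 < delta1 δ₀ κ M := delta1_pos hs.δ₀_pos hs.κ_pos hs.M_pos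
  have hAk : 0 ≤ A (p (Fin.last k)) := hs.act _ (hp (Fin.last k)).1 (hp (Fin.last k)).2
  have hdec := (R.leaves k p hp).decay510 hs.α₂_pos hAk hs.B₃_nonneg hs.K₀_nonneg hs.δ₀_pos.le hs.κ_pos.le
    hs.M_pos
  rw [R.beta1_eq k p hp]
  exact abs_secondMoment_le_linear hδ₁ hdec

/-- **THE CONSTANT FORM ON THE BOX `]0,γ]^{k+1}`** for a budget monotone on `]0,γ]`: `RemainderConst S γ (A γ · K)`. -/
theorem ChainVar.remainderConst {μ ν : Fin d} {β : HBeta} {S : B12Beta.OneLoopSplit β} {γ : ℝ} {A : ℝ → ℝ}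
    {α₂ B₃ κ δ₀ M c₁ K₀ K₁ : ℝ} (R : ChainVar d μ ν S γ A α₂ B₃ κ δ₀ M c₁ K₀ K₁)
    (hs : VarSigns A γ α₂ B₃ K₀ K₁ δ₀ κ M) (hmono : MonotoneOn A (Ioc 0 γ)) :
    RemainderConst S γ (A γ * modCoeff d α₂ B₃ κ δ₀ M c₁ K₀ K₁) := by
  have hK := modCoeff_nonneg d (α₂ := α₂) (B₃ := B₃) (κ := κ) (δ₀ := δ₀) (M := M) (c₁ := c₁) hs.K₀_nonneg
    hs.K₁_nonneg
  refine remainderConst_of_mod (R.abs_beta1_le hs) ?_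
  intro x hx y hy hxy
  exact mul_le_mul_of_nonneg_right (hmono hx hy hxy) hK

/-! ## §3 The threshold by shrinking γ — no inserted numeric restriction -/

/-- [folklore] **(hr) BY LIMIT.**  If the budget tends to 0 at 0⁺, then for every `K ≥ 0`, `b > 0`, `γ₀ > 0` there is
`γ₁ ∈ ]0, γ₀]` with `A γ₁ · K < b`.  (The clause «γ sufficiently small, depending on all other constants» of [I] Thm 3
p. 264; compare road P1's N3, an UPPER bound on ε₁ inserted before γ.) -/
theorem exists_threshold {A : ℝ → ℝ} (hA : Tendsto A (𝓝[>] (0 : ℝ)) (𝓝 0)) {K b γ₀ : ℝ} (hK : 0 ≤ K)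
    (hb : 0 < b) (hγ₀ : 0 < γ₀) : ∃ γ₁ : ℝ, 0 < γ₁ ∧ γ₁ ≤ γ₀ ∧ A γ₁ * K < b := by
  have hpos : 0 < b / (K + 1) := div_pos hb (by linarith)
  have h1 : ∀ᶠ g in 𝓝[>] (0 : ℝ), A g < b / (K + 1) := (tendsto_order.1 hA).2 _ hpos
  have h2 : ∀ᶠ g in 𝓝[>] (0 : ℝ), g ∈ Ioo 0 γ₀ := Ioo_mem_nhdsGT hγ₀
  obtain ⟨g, hgA, hg⟩ := (h1.and h2).exists
  refine ⟨g, hg.1, hg.2.le, ?_⟩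
  by_cases hAg : 0 ≤ A g
  · calc A g * K ≤ A g * (K + 1) := by nlinarith
      _ < b / (K + 1) * (K + 1) := by
          exact mul_lt_mul_of_pos_right hgA (by linarith)
      _ = b := by field_simp
  · have : A g * K ≤ 0 := mul_nonpos_of_nonpos_of_nonneg (le_of_not_ge hAg) hK
    linarith

/-! ## §4 The wall END for road P2′ (abstract carrier): drift + variable-budget chain + continuity, NO threshold hypothesis -/

/-- **ENDPOINT EXISTENCE FROM THE ONE-LOOP DRIFT, A VARIABLE-BUDGET REMAINDER CHAIN WITH VANISHING BUDGET, AND (C)** —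
the (D4) slot of `DriftRemainder.endpointExistence_of_drift_remainderConst_cont` filled by `ChainVar` on SOME box
`]0,γ₀]`, with the threshold `r ≤ b` DISCHARGED by shrinking γ (`exists_threshold`): no N3-type restriction appears among
the hypotheses.  The remaining binders are the wall's: `hgen`, the split `S`, the drift (row D1/CAP), continuity (row hcont). -/
theorem endpointExistence_of_chainVar {C : B12.Construction} {β : HBeta} (hgen : ForwardGenerated C β)
    (S : B12Beta.OneLoopSplit β) {μ ν : Fin d} {γ₀ b Adr : ℝ} {A : ℝ → ℝ} {α₂ B₃ κ δ₀ M c₁ K₀ K₁ : ℝ}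
    (R : ChainVar d μ ν S γ₀ A α₂ B₃ κ δ₀ M c₁ K₀ K₁) (hs : VarSigns A γ₀ α₂ B₃ K₀ K₁ δ₀ κ M)
    (hmono : MonotoneOn A (Ioc 0 γ₀)) (hA : Tendsto A (𝓝[>] (0 : ℝ)) (𝓝 0))
    (hγ₀ : 0 < γ₀) (hb : 0 < b) (hdrift : OneLoopDrift b Adr S.β0) (hcont : BetaContH γ₀ β) :
    EndpointExistence C := by
  have hK := modCoeff_nonneg d (α₂ := α₂) (B₃ := B₃) (κ := κ) (δ₀ := δ₀) (M := M) (c₁ := c₁) hs.K₀_nonneg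
    hs.K₁_nonneg
  obtain ⟨γ₁, hγ₁, hγ₁₀, hlt⟩ := exists_threshold hA hK hb hγ₀
  have hrem : RemainderConst S γ₁ (A γ₁ * modCoeff d α₂ B₃ κ δ₀ M c₁ K₀ K₁) :=
    (R.restrict hγ₁₀).remainderConst (hs.anti hγ₁₀) (hmono.mono fun x hx => ⟨hx.1, hx.2.trans hγ₁₀⟩)
  have hcont' : BetaContH γ₁ β := fun k => (hcont k).mono (box_mono hγ₁₀ k)
  exact endpointExistence_of_drift_remainderConst_cont hgen S hγ₁ hdrift hrem hlt.le hcont'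

/-! ## §5 The PERIODIC carrier: the owner's torus leaf list with the [II]-side fields replaced by the (I.1.18)-level field

`RemainderChainTorus.PolLeavesT` carries `hsp`/`hrep`/`h238` (restriction property, (2.13) representation, Lemma 3) and
DERIVES the (I.1.18)-leaf by the Kotecký–Preiss resummation (`PolLeavesT.h118`).  On road P2′ the resummation is the
MARKED one of [III] (3.44)–(3.47) (skeleton NODE R) and its output IS an (I.1.18)-level bound with budget `Abud`; so the
torus leaf list of road P2′ takes `h118` as its [II]/[III]-side field and keeps every [I]-side field of the owner's list. -/

/-- **THE TORUS LEAF LIST OF ROAD P2′** (`PolLeavesT` with `hsp`, `hrep`, `h238`, `W`, `emb`, `hemb`, `hcomp` replaced by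
`h118`): tori with `N n → ∞` cubes per direction; external-field spaces `Wn n`; the β¹-generating terms `EXn n X` read on
the α₂-ball ([I] (4.4), ABSOLUTE radius — the point of road P2′ vs [III]'s (2.28)); `h118` = the (I.1.18)-level bound with
budget `Abud` and rate κ in the torus tree length (output of NODE R); the (4.35) representation `hrepr`, the p. 282 decay
`hh` of the test configurations, the (5.1) limit `hlim` — verbatim the owner's fields.  A HYPOTHESIS structure. -/
structure PolLeavesT118 (d M : ℕ) [NeZero M] (P : (Fin d → ℤ) → ℝ) (Abud κ δ₀ α₂ B₃ : ℝ) where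
  N : ℕ → ℕ
  [hN : ∀ n, NeZero (N n)]
  hNlim : Tendsto N atTop atTop
  Wn : ℕ → Type
  [instW : ∀ n, NormedAddCommGroup (Wn n)]
  [instWs : ∀ n, NormedSpace ℂ (Wn n)]
  EXn : (n : ℕ) → TDom d (N n) → Wn n → ℂ
  hn : (n : ℕ) → TDom d (N n) → TPt d (N n * M) → Wn n
  E2n : (n : ℕ) → TDom d (N n) → TPt d (N n * M) → TPt d (N n * M) → ℝ
  han : ∀ n X, AnalyticOnNhd ℂ (EXn n X) (ball 0 α₂)
  h118 : ∀ n X, ∀ v ∈ ball (0 : Wn n) α₂, ‖EXn n X v‖ ≤ Abud * Real.exp (-κ * torusTreeLen X.1)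
  hrepr : ∀ n X x y, E2n n X x y = (mixedDeriv (EXn n X) (hn n X x) (hn n X y)).re
  hh : ∀ n X x, ‖hn n X x‖ ≤ B₃ * Real.exp (-δ₀ * distCT (N n) M x (nearT (M := M) x X))
  hlim : ∀ z, Tendsto (fun n => ∑ X : TDom d (N n), E2n n X (proj (N n * M) 0) (proj (N n * M) z)) atTop (𝓝 (P z))

/-- **The road-P2′ torus leaves give the owner's abstract leaves** with activity `Abud`, rate κ and the SAME slots
(M′, c₁, K₀, K₁) = (M·d, 3, K₀(4·2^d, 2d), K₁(d, δ₀/2)) — geometry leaf, cube sum, tree sum and the metric leaf PROVED on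
the torus by the owner's lineage (`B12Decay510Torus.geomLeafT`, `cubeSumLeafT`, `treeLeafT`,
`pl1_proj_zero_sub_proj_eventually`), under the tree-sum rate condition `κ₀(4·2^d, 2d) ≤ κ/2` and `δ₀ > 0`. -/
def PolLeavesT118.toPolLeaves {M : ℕ} [NeZero M] {P : (Fin d → ℤ) → ℝ} {Abud κ δ₀ α₂ B₃ : ℝ}
    (Lv : PolLeavesT118 d M P Abud κ δ₀ α₂ B₃) (htree : kappa₀ (4 * 2 ^ d) (2 * d) ≤ κ / 2) (hδ₀ : 0 < δ₀) :
    PolLeaves d P Abud α₂ B₃ κ δ₀ ((M : ℝ) * d) 3 (K₀ (4 * 2 ^ d) (2 * d)) (K₁ d (δ₀ / 2)) :=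
  letI := Lv.hN
  { Sn := fun n => tsys d (Lv.N n)
    Cn := fun n => (tcubeSys d (Lv.N n)).toCubeCover
    Λn := fun n => TPt d (Lv.N n * M)
    Gn := fun n => geomT d (Lv.N n) M
    ρn := fun _ x y => pl1 (x - y)
    Wn := Lv.Wn
    instW := Lv.instW
    instWs := Lv.instWs
    EXn := Lv.EXn
    hn := Lv.hn
    E2n := Lv.E2n
    e := fun n z => proj (Lv.N n * M) z
    han := Lv.han
    h118 := Lv.h118
    hrepr := Lv.hrepr
    hh := Lv.hh
    hgeo := fun n => geomLeafT d (Lv.N n) M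
    hcube := fun n => cubeSumLeafT d (Lv.N n) M (half_pos hδ₀)
    htree := fun n => treeLeafT d (Lv.N n) htree
    hρ := pl1_proj_zero_sub_proj_eventually Lv.N Lv.hNlim
    hlim := Lv.hlim }

/-- **THE ROAD-P2′ CHAIN ON THE PERIODIC CARRIER**: per scale k and history p in `]0,γ]^{k+1}`, the torus leaf list with
budget `A (p (Fin.last k))` — ONE κ, δ₀, α₂, B₃, M for all k, p.  A HYPOTHESIS structure. -/
structure ChainVarT (d M : ℕ) [NeZero M] (μ ν : Fin d) {β : HBeta} (S : B12Beta.OneLoopSplit β) (γ : ℝ)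
    (A : ℝ → ℝ) (κ δ₀ α₂ B₃ : ℝ) where
  P1 : (k : ℕ) → (Fin (k + 1) → ℝ) → B12Beta.Kernel d
  beta1_eq : ∀ k p, p ∈ B12Beta.HistBox γ k → S.β1 k p = B12Beta.secondMoment (P1 k p) μ ν
  leaves : ∀ k (p : Fin (k + 1) → ℝ), p ∈ B12Beta.HistBox γ k →
    PolLeavesT118 d M (P1 k p μ ν) (A (p (Fin.last k))) κ δ₀ α₂ B₃

/-- A torus chain IS an abstract variable-budget chain at the slots (M·d, 3, K₀(4·2^d, 2d), K₁(d, δ₀/2)). -/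
def ChainVarT.toChainVar {M : ℕ} [NeZero M] {μ ν : Fin d} {β : HBeta} {S : B12Beta.OneLoopSplit β} {γ : ℝ}
    {A : ℝ → ℝ} {κ δ₀ α₂ B₃ : ℝ} (R : ChainVarT d M μ ν S γ A κ δ₀ α₂ B₃)
    (htree : kappa₀ (4 * 2 ^ d) (2 * d) ≤ κ / 2) (hδ₀ : 0 < δ₀) :
    ChainVar d μ ν S γ A α₂ B₃ κ δ₀ ((M : ℝ) * d) 3 (K₀ (4 * 2 ^ d) (2 * d)) (K₁ d (δ₀ / 2)) where
  P1 := R.P1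
  beta1_eq := R.beta1_eq
  leaves := fun k p hp => (R.leaves k p hp).toPolLeaves htree hδ₀

/-- The road-P2′ remainder coefficient on the periodic carrier, FULLY VALUED: `K_rem′ := β′_d(K_Π,L, δ₁)` with
`K_Π,L = 4α₂⁻²B₃²e^{3Mdδ₁}K₀(4·2^d,2d)K₁(d,δ₀/2)`, `δ₁ = ½min{δ₀, κ(Md)⁻¹}` — the owner's `remCoeffL` without its
factor `A₂C₃` (which on road P2′ lives inside the budget `A`). -/
def remCoeffVar (d M : ℕ) (κ δ₀ α₂ B₃ : ℝ) : ℝ :=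
  modCoeff d α₂ B₃ κ δ₀ ((M : ℝ) * d) 3 (K₀ (4 * 2 ^ d) (2 * d)) (K₁ d (δ₀ / 2))

/-- `K_rem′ ≥ 0`. -/
theorem remCoeffVar_nonneg (d M : ℕ) (κ δ₀ α₂ B₃ : ℝ) : 0 ≤ remCoeffVar d M κ δ₀ α₂ B₃ := by
  unfold remCoeffVar
  refine modCoeff_nonneg d (K₀_pos _ _).le ?_
  unfold K₁
  exact tsum_nonneg fun _ => (Real.exp_pos _).le

/-- The tree-sum condition forces `κ > 0`. -/
theorem kappa_pos_of_tree {κ : ℝ} (htree : kappa₀ (4 * 2 ^ d) (2 * d) ≤ κ / 2) : 0 < κ := by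
  have := Beta.RemainderChainLattice.kappa₀_pos (c₀ := 4 * 2 ^ d) (by positivity) (2 * d)
  linarith

/-- **THE ω-FORM ON THE PERIODIC CARRIER**: `|β¹_{k+1}(p)| ≤ A(g_k) · K_rem′` for every k and every history in
`]0,γ]^{k+1}`, under the budget's sign, `α₂ > 0`, `B₃ ≥ 0`, `δ₀ > 0`, the tree-sum rate condition and `d, M > 0`. -/
theorem ChainVarT.abs_beta1_le {M : ℕ} [NeZero M] {μ ν : Fin d} {β : HBeta} {S : B12Beta.OneLoopSplit β}
    {γ : ℝ} {A : ℝ → ℝ} {κ δ₀ α₂ B₃ : ℝ} (R : ChainVarT d M μ ν S γ A κ δ₀ α₂ B₃)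
    (hact : ∀ g, 0 < g → g ≤ γ → 0 ≤ A g) (hα₂ : 0 < α₂) (hB₃ : 0 ≤ B₃) (hδ₀ : 0 < δ₀)
    (htree : kappa₀ (4 * 2 ^ d) (2 * d) ≤ κ / 2) (hd : 0 < d) :
    RemainderMod S γ (fun g => A g * remCoeffVar d M κ δ₀ α₂ B₃) := by
  have hs : VarSigns A γ α₂ B₃ (K₀ (4 * 2 ^ d) (2 * d)) (K₁ d (δ₀ / 2)) δ₀ κ ((M : ℝ) * d) :=
    ⟨hact, hα₂, hB₃, (K₀_pos _ _).le, tsum_nonneg fun _ => (Real.exp_pos _).le, hδ₀, kappa_pos_of_tree htree,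
      mul_pos (Nat.cast_pos.2 (Nat.pos_of_neZero M)) (Nat.cast_pos.2 hd)⟩
  exact (R.toChainVar htree hδ₀).abs_beta1_le hs

/-- **THE ROAD-P2′ WALL END ON THE PERIODIC CARRIER** — binders: `hgen`, the split `S`, a torus chain `R` with budget `A`
(non-negative and monotone on `]0,γ₀]`, tending to 0 at 0⁺), the printed signs and the tree-sum rate condition, the one-loop
drift with constant `b > 0` (rows D1/CAP), continuity (row hcont).  NO `r ≤ b` hypothesis. -/
theorem endpointExistence_of_chainVarT {M : ℕ} [NeZero M] {C : B12.Construction} {β : HBeta}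
    (hgen : ForwardGenerated C β) (S : B12Beta.OneLoopSplit β) {μ ν : Fin d} {γ₀ b Adr : ℝ} {A : ℝ → ℝ}
    {κ δ₀ α₂ B₃ : ℝ} (R : ChainVarT d M μ ν S γ₀ A κ δ₀ α₂ B₃)
    (hact : ∀ g, 0 < g → g ≤ γ₀ → 0 ≤ A g) (hmono : MonotoneOn A (Ioc 0 γ₀))
    (hA : Tendsto A (𝓝[>] (0 : ℝ)) (𝓝 0)) (hα₂ : 0 < α₂) (hB₃ : 0 ≤ B₃) (hδ₀ : 0 < δ₀)
    (htree : kappa₀ (4 * 2 ^ d) (2 * d) ≤ κ / 2) (hd : 0 < d)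
    (hγ₀ : 0 < γ₀) (hb : 0 < b) (hdrift : OneLoopDrift b Adr S.β0) (hcont : BetaContH γ₀ β) :
    EndpointExistence C := by
  have hs : VarSigns A γ₀ α₂ B₃ (K₀ (4 * 2 ^ d) (2 * d)) (K₁ d (δ₀ / 2)) δ₀ κ ((M : ℝ) * d) :=
    ⟨hact, hα₂, hB₃, (K₀_pos _ _).le, tsum_nonneg fun _ => (Real.exp_pos _).le, hδ₀, kappa_pos_of_tree htree,
      mul_pos (Nat.cast_pos.2 (Nat.pos_of_neZero M)) (Nat.cast_pos.2 hd)⟩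
  exact endpointExistence_of_chainVar hgen S (R.toChainVar htree hδ₀) hs hmono hA hγ₀ hb hdrift hcont

end

end Summit.QuantumFields.BalabanUV.Beta.RoadP2Chain
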